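import Literature.Probability.RandomPlanarGeometry.WholePlaneLoewnerBackwardChain
import Literature.Probability.RandomPlanarGeometry.WholePlaneLoewnerDefs
import HarnessLib

/-!
# The radial Markov property of whole-plane Loewner chains

Topic `Probability/RandomPlanarGeometry`; theorems only, sequel of `WholePlaneSLEProofs` /
`WholePlaneLoewnerBackwardChain` / `WholePlaneLoewnerDefs`. Miller–Sheffield (2013), §2.1.3: "Note that (the whole-plane Loewner
equation) is the same as (the radial one). In fact, for any `s ∈ ℝ`, the growth process
`1/g_s(K_t ∖ K_s)` for `t ≥ s` from `∂𝔻` to `0` is a radial SLE_κ process in `𝔻`. Thus, whole-plane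
SLE can be thought of as a bi-infinite time version of radial SLE." The DETERMINISTIC content of
this sentence — valid for every whole-plane Loewner chain `C` with a continuous driving angle `lam`
(`WholePlaneLoewnerChain`, Lawler (2005), Prop. 4.21) and every base time `b ∈ ℝ` — is proved here,
in the vocabulary of the tree's radial Loewner chain in the unit disc (`RadialLoewnerChain`:
`RadialLoewner.Disc.IsSolution / swallowingTime / hull / domain / map`) driven by the shifted
driver `WholePlaneLoewner.shiftDriver lam b = (u ↦ -lam (b + u))` of `WholePlaneLoewnerDefs`
(interior driving point `e^{-i lam}`, Lawler (2005), Remark 4.22):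

* `WholePlaneLoewnerChain.hull_eq_loewnerHull`, `map_eq_loewnerMap` — by uniqueness
  (`WholePlaneLoewnerChain.unique`) every chain is the backward-flow chain of
  `WholePlaneLoewnerBackwardChain`; hence `exists_forall_notMem_hull` (a point off `K_t` is off
  `K_s` for all `s ≤ t + ε`) and the right-continuity `hull_eq_iInter_Ioi` of the hulls;
* `WholePlaneLoewnerChain.notMem_hull_of_solution` — **forward solutions determine the chain**: a
  solution `u` of the whole-plane equation on `[b, T]` outside the closed unit disc with
  `u b = g_b(z)`, `z ∉ K_b`, forces `z ∉ K_T` and `g_T(z) = u T` (backward uniqueness against the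
  backward orbit through `(T, u T)` and the flow property of `F_t = invMap`);
* `WholePlaneLoewnerChain.invMap_map`, `map_invMap`, `image_invMap_eq_compl_hull` — the inverse Loewner map of
  any chain is the backward-flow limit `F_t = WholePlaneLoewner.BackwardFlow.invMap lam t` of
  `WholePlaneLoewnerBackwardMaps` (holomorphic and injective on `{1 < |w|}` there);
* **the radial Markov property** (`notMem_hull_add_iff`, `mem_hull_add_iff`, `map_add_eq`,
  `compl_hull_add_eq`, `image_invCoord_diff_hull`, `image_invCoord_compl_hull`): for `z ∉ K_b` and
  `w₀ = 1/g_b(z) ∈ 𝔻 ∖ {0}`, `z ∈ K_{b+u}` iff `w₀` is swallowed by time `u` by the radial Loewner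
  chain in `𝔻` driven by the shifted driver, and `g_{b+u}(z) = 1/k_u(w₀)` with `k_u` its Loewner
  map while alive; i.e. `w ↦ 1/g_b` carries `K_{b+u} ∖ K_b` onto the radial hull at time `u` and
  `ℂ ∖ K_{b+u}` onto the radial domain minus the origin.

Two complements on the radial flow in `𝔻` are proved on the way (`RadialLoewner.Disc.map_eq_of_isSolution`:
the Loewner map is the value of any solution alive at that time; `IsSolution.ne_zero`: a solution
started off the origin never visits it). Everything is proved; no named fact is introduced.

## References

* J. Miller, S. Sheffield, *Imaginary geometry IV: interior rays, whole-plane reversibility, and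
  space-filling trees*, PTRF 169 (2017), arXiv:1302.4738, §2.1.3. [MillerSheffield2013]
* G. F. Lawler, *Conformally Invariant Processes in the Plane*, AMS (2005), §4.3, Prop. 4.21,
  Remark 4.22. [Lawler2005]
-/

noncomputable section

open Set Filter Topology Complex Metric
open scoped NNReal

namespace Literature.Probability.RandomPlanarGeometry

/-! ### Two complements on the radial Loewner flow in the unit disc -/

namespace RadialLoewner.Disc

variable {U : ℝ≥0 → ℝ} {z : ℂ} {g : ℝ → ℂ} {T : WithTop ℝ≥0}

/-- **The radial Loewner map is the value of any solution alive at that time** (well defined by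
uniqueness of the flow, `IsSolution.eqOn`). [folklore] -/
theorem map_eq_of_isSolution (hU : Continuous U) (h : IsSolution U z g T) {t : ℝ≥0}
    (ht : (t : WithTop ℝ≥0) < T) : map U t z = g t := by
  classical
  have hex : ∃ p : (ℝ → ℂ) × WithTop ℝ≥0, IsSolution U z p.1 p.2 ∧ (t : WithTop ℝ≥0) < p.2 :=
    ⟨(g, T), h, ht⟩
  rw [map, dif_pos hex]
  obtain ⟨hp, htp⟩ := hex.choose_spec
  have hmem : (t : ℝ) ∈ timeDom (min hex.choose.2 T) :=
    ⟨t.2, by simpa only [Real.toNNReal_coe, lt_min_iff] using ⟨htp, ht⟩⟩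
  exact IsSolution.eqOn hU hp h hmem

/-- Derivative of an integral curve within `(-∞, t]` at a time `t ∈ (0, b]`, `[0, b] ⊆ D`.
[folklore] -/
theorem hasDerivWithinAt_Iic_of_isIntegralCurveOn {D : Set ℝ} {f : ℝ → ℂ} {b : ℝ}
    (hD : Icc 0 b ⊆ D) (hf : IsIntegralCurveOn f (field U) D) :
    ∀ t ∈ Ioc 0 b, HasDerivWithinAt f (field U t (f t)) (Iic t) t := by
  intro t ht
  have h1 : HasDerivWithinAt f (field U t (f t)) (Icc 0 t) t :=
    (hf t (hD ⟨ht.1.le, ht.2⟩)).mono fun s hs ↦ hD ⟨hs.1, hs.2.trans ht.2⟩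
  exact h1.mono_of_mem_nhdsWithin (Icc_mem_nhdsLE ht.1)

/-- **A solution started off the origin never visits it**: `z ≠ 0 ⇒ g t ≠ 0` on `[0, T)`
(the origin is a stationary solution, `isSolution_zero`; backward uniqueness of the Lipschitz
flow, Mathlib's `ODE_solution_unique_of_mem_Icc_left`). [folklore] -/
theorem IsSolution.ne_zero (hU : Continuous U) (h : IsSolution U z g T) (hz : z ≠ 0) {t : ℝ}
    (ht : t ∈ timeDom T) : g t ≠ 0 := by
  intro hgt
  obtain ⟨ht0, htT⟩ := ht
  obtain ⟨δ, hδ, hfar⟩ := h.exists_le_norm_sub hU ht0 htT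
  set δ' : ℝ≥0 := min δ 1 with hδ'def
  have hδ' : 0 < δ' := lt_min hδ one_pos
  set M : ℝ≥0 := ⟨‖z‖ + 2, by positivity⟩ with hMdef
  have hsub : Icc 0 t ⊆ timeDom T := Loewner.Icc_subset_timeDomain htT
  have key := ODE_solution_unique_of_mem_Icc_left (v := field U)
    (s := fun r ↦ {w : ℂ | (δ' : ℝ) ≤ ‖drivingPt U r - w‖ ∧ ‖w‖ ≤ M})
    (K := (1 + M) ^ 2 / δ' ^ 2) (f := g) (g := fun _ ↦ (0 : ℂ)) (a := 0) (b := t)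
    (fun r _ ↦ lipschitzOnWith_field U r hδ' M) (h.continuousOn.mono hsub)
    (hasDerivWithinAt_Iic_of_isIntegralCurveOn hsub h.isIntegralCurveOn)
    (fun r hr ↦ ⟨((NNReal.coe_le_coe.2 (min_le_left δ 1)).trans (hfar r ⟨hr.1.le, hr.2⟩)),
      h.norm_le hr.1.le (hsub ⟨hr.1.le, hr.2⟩).2⟩)
    continuousOn_const
    (fun r _ ↦ by
      have h0 : field U r 0 = 0 := by simp [field_apply]
      rw [h0]
      exact hasDerivWithinAt_const _ _ _)
    (fun r _ ↦ ⟨by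
      rw [sub_zero, norm_drivingPt]
      exact_mod_cast min_le_right δ 1, by simp⟩)
    hgt
  have h00 : g 0 = 0 := key ⟨le_rfl, ht0⟩
  rw [h.apply_zero] at h00
  exact hz h00

end RadialLoewner.Disc

/-! ### Forward solutions outside the disc determine the backward-flow chain -/

namespace WholePlaneLoewner.BackwardFlow

variable {lam : ℝ → ℝ}

/-- **Forward solutions are the chain.** Let `z ∈ D_b` and let `u : [b, T] → {1 < |w|}` be a
solution of the whole-plane equation `u̇ = V(s, u)` with `u b = g_b(z)`. Then `z ∈ D_T` and
`g_T(z) = u T`: the backward orbit through `(T, u T)` coincides with `u` on `[b, T]` (backward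
uniqueness, `ODE_solution_unique_of_mem_Icc_left`), so `F_T(u T) = F_b(u b) = F_b(g_b z) = z` by the
flow property `invMap_orbit`. [cite: Lawler2005, §4.3 Prop. 4.21] -/
theorem mem_loewnerDomain_of_solution (hlam : Continuous lam) {b T : ℝ} (hbT : b ≤ T) {z : ℂ}
    (hz : z ∈ loewnerDomain lam b) {u : ℝ → ℂ} (hub : u b = loewnerMap lam b z)
    (hcont : ContinuousOn u (Icc b T))
    (hd : ∀ s ∈ Ioc b T, HasDerivWithinAt u (field lam s (u s)) (Iic s) s)
    (hn : ∀ s ∈ Icc b T, 1 < ‖u s‖) :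
    z ∈ loewnerDomain lam T ∧ loewnerMap lam T z = u T := by
  set w := u T with hwdef
  have hw : 1 < ‖w‖ := hn T ⟨hbT, le_rfl⟩
  -- a uniform margin `m > 1` below `|u|` on `[b, T]`
  obtain ⟨m, hm1, hm⟩ : ∃ m : ℝ, 1 < m ∧ ∀ s ∈ Icc b T, m ≤ ‖u s‖ := by
    obtain ⟨s₀, hs₀, hmin⟩ := (isCompact_Icc (a := b) (b := T)).exists_isMinOn
      (nonempty_Icc.2 hbT) hcont.norm
    exact ⟨‖u s₀‖, hn s₀ hs₀, fun s hs ↦ hmin hs⟩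
  have hmw : m ≤ ‖w‖ := hm T ⟨hbT, le_rfl⟩
  set δ : ℝ≥0 := ⟨m - 1, by linarith⟩ with hδdef
  have hδpos : 0 < δ := by change (0 : ℝ) < m - 1; linarith
  have hδm : 1 + (δ : ℝ) = m := by change 1 + (m - 1) = m; ring
  have key := ODE_solution_unique_of_mem_Icc_left (v := field lam)
    (s := fun _ ↦ {x : ℂ | 1 + (δ : ℝ) ≤ ‖x‖}) (f := u) (g := orbit lam T w) (a := b) (b := T)
    (fun r _ ↦ lipschitzOnWith_field lam r hδpos) hcont hd
    (fun r hr ↦ by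
      change 1 + (δ : ℝ) ≤ ‖u r‖
      rw [hδm]; exact hm r ⟨hr.1.le, hr.2⟩)
    ((continuousOn_orbit (t := T) hlam hw).mono fun r hr ↦
      (show r ≤ T + 1 from hr.2.trans (by linarith)))
    (fun r hr ↦ (hasDerivAt_orbit hlam hw hr.2).hasDerivWithinAt)
    (fun r hr ↦ by
      change 1 + (δ : ℝ) ≤ ‖orbit lam T w r‖
      rw [hδm]; exact hmw.trans (norm_le_norm_orbit hlam hw hr.2))
    (by rw [orbit_self hlam hw])
  have hub' : orbit lam T w b = loewnerMap lam b z := by rw [← key ⟨le_rfl, hbT⟩, hub]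
  have hz' : invMap lam T w = z := by
    rw [← invMap_orbit hlam hw hbT, hub', invMap_loewnerMap hz]
  exact ⟨hz' ▸ invMap_mem_loewnerDomain T hw, loewnerMap_eq_of_invMap_eq hlam hw hz'⟩

end WholePlaneLoewner.BackwardFlow

namespace WholePlaneLoewnerChain

variable {lam : ℝ → ℝ}

/-! ### Every chain is the backward-flow chain; right-continuity of the hulls -/

/-- By uniqueness, the hulls of any whole-plane Loewner chain with continuous driving angle are the
hulls of the backward-flow chain. [cite: Lawler2005, §4.3 Prop. 4.21] -/
theorem hull_eq_loewnerHull (C : WholePlaneLoewnerChain lam) (hlam : Continuous lam) (t : ℝ) :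
    C.hull t = WholePlaneLoewner.BackwardFlow.loewnerHull lam t :=
  (C.unique (WholePlaneLoewner.BackwardFlow.chain hlam) t).1

/-- Off the hull, `z ∉ K_t` iff `z` is in the backward-flow Loewner domain `D_t`. [folklore] -/
theorem notMem_hull_iff_mem_loewnerDomain (C : WholePlaneLoewnerChain lam) (hlam : Continuous lam)
    {t : ℝ} {z : ℂ} : z ∉ C.hull t ↔ z ∈ WholePlaneLoewner.BackwardFlow.loewnerDomain lam t := by
  rw [C.hull_eq_loewnerHull hlam, ← WholePlaneLoewner.BackwardFlow.compl_loewnerHull]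
  rfl

/-- By uniqueness, the maps of any chain are the backward-flow maps off the hull.
[cite: Lawler2005, §4.3 Prop. 4.21] -/
theorem map_eq_loewnerMap (C : WholePlaneLoewnerChain lam) (hlam : Continuous lam) {t : ℝ} {z : ℂ}
    (hz : z ∉ C.hull t) : C.map t z = WholePlaneLoewner.BackwardFlow.loewnerMap lam t z :=
  (C.unique (WholePlaneLoewner.BackwardFlow.chain hlam) t).2 hz

/-- **A point off `K_t` stays off the hulls a little longer**: `z ∉ K_s` for all `s ≤ t + ε`,
some `ε > 0` (forward extension of the trajectory through `(t, g_t z)`). [folklore] -/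
theorem exists_forall_notMem_hull (C : WholePlaneLoewnerChain lam) (hlam : Continuous lam)
    {t : ℝ} {z : ℂ} (hz : z ∉ C.hull t) : ∃ ε > 0, ∀ s ≤ t + ε, z ∉ C.hull s := by
  obtain ⟨ε, hε, h⟩ := WholePlaneLoewner.BackwardFlow.exists_loewnerMap_eq_orbit hlam
    ((C.notMem_hull_iff_mem_loewnerDomain hlam).1 hz)
  exact ⟨ε, hε, fun s hs ↦ (C.notMem_hull_iff_mem_loewnerDomain hlam).2 (h s hs).1⟩

/-- **Right-continuity of the hulls**: `K_t = ⋂_{s > t} K_s`. [folklore] -/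
theorem hull_eq_iInter_Ioi (C : WholePlaneLoewnerChain lam) (hlam : Continuous lam) (t : ℝ) :
    C.hull t = ⋂ s ∈ Ioi t, C.hull s := by
  refine Subset.antisymm (subset_iInter₂ fun s hs ↦ C.hull_mono (le_of_lt hs)) fun z hz ↦ ?_
  by_contra hzt
  obtain ⟨ε, hε, h⟩ := C.exists_forall_notMem_hull hlam hzt
  exact h (t + ε) le_rfl (mem_iInter₂.1 hz (t + ε) (by simp [hε]))

/-- **Forward solutions determine the chain** (chain form of
`WholePlaneLoewner.BackwardFlow.mem_loewnerDomain_of_solution`): a solution `u` of the whole-plane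
equation on `[b, T]` outside the closed unit disc with `u b = g_b(z)`, `z ∉ K_b`, gives `z ∉ K_T`
and `g_T(z) = u T`. [cite: Lawler2005, §4.3 Prop. 4.21] -/
theorem notMem_hull_of_solution (C : WholePlaneLoewnerChain lam) (hlam : Continuous lam) {b T : ℝ}
    (hbT : b ≤ T) {z : ℂ} (hz : z ∉ C.hull b) {u : ℝ → ℂ} (hub : u b = C.map b z)
    (hcont : ContinuousOn u (Icc b T))
    (hd : ∀ s ∈ Ioc b T, HasDerivWithinAt u (WholePlaneLoewner.field lam s (u s)) (Iic s) s)
    (hn : ∀ s ∈ Icc b T, 1 < ‖u s‖) : z ∉ C.hull T ∧ C.map T z = u T := by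
  rw [C.map_eq_loewnerMap hlam hz] at hub
  obtain ⟨hzT, hmap⟩ := WholePlaneLoewner.BackwardFlow.mem_loewnerDomain_of_solution hlam hbT
    ((C.notMem_hull_iff_mem_loewnerDomain hlam).1 hz) hub hcont hd hn
  have hzT' : z ∉ C.hull T := (C.notMem_hull_iff_mem_loewnerDomain hlam).2 hzT
  exact ⟨hzT', by rw [C.map_eq_loewnerMap hlam hzT', hmap]⟩

/-! ### The inverse Loewner map is the backward-flow limit `F_t = invMap lam t` -/

/-- `g_t` is a bijection `ℂ ∖ K_t → {1 < |w|}`. [folklore] -/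
theorem bijOn_map (C : WholePlaneLoewnerChain lam) (t : ℝ) : BijOn (C.map t) (C.hull t)ᶜ exteriorDisc := by
  obtain ⟨φ, hφ⟩ := C.exists_conformalEquiv t
  exact (Set.EqOn.bijOn_iff hφ).2 φ.bijOn

/-- `g_t` is continuous on `ℂ ∖ K_t`. [folklore] -/
theorem continuousOn_map (C : WholePlaneLoewnerChain lam) (t : ℝ) : ContinuousOn (C.map t) (C.hull t)ᶜ := by
  obtain ⟨φ, hφ⟩ := C.exists_conformalEquiv t
  exact φ.continuousOn.congr hφ

/-- **The inverse Loewner map of any chain is the backward-flow limit** `F_t = invMap lam t`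
(`WholePlaneLoewnerBackwardMaps`; Lawler (2005), Prop. 4.21, `F_t = lim F_t^{(s)}`):
`F_t (g_t z) = z` for `z ∉ K_t`. [cite: Lawler2005, §4.3 Prop. 4.21] -/
theorem invMap_map (C : WholePlaneLoewnerChain lam) (hlam : Continuous lam) {t : ℝ} {z : ℂ}
    (hz : z ∉ C.hull t) : WholePlaneLoewner.BackwardFlow.invMap lam t (C.map t z) = z := by
  rw [C.map_eq_loewnerMap hlam hz]
  exact WholePlaneLoewner.BackwardFlow.invMap_loewnerMap
    ((C.notMem_hull_iff_mem_loewnerDomain hlam).1 hz)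

/-- `F_t w ∉ K_t` for `1 < |w|`. [folklore] -/
theorem invMap_notMem_hull (C : WholePlaneLoewnerChain lam) (hlam : Continuous lam) {t : ℝ} {w : ℂ}
    (hw : 1 < ‖w‖) : WholePlaneLoewner.BackwardFlow.invMap lam t w ∉ C.hull t :=
  (C.notMem_hull_iff_mem_loewnerDomain hlam).2
    (WholePlaneLoewner.BackwardFlow.invMap_mem_loewnerDomain t hw)

/-- `g_t (F_t w) = w` for `1 < |w|`. [folklore] -/
theorem map_invMap (C : WholePlaneLoewnerChain lam) (hlam : Continuous lam) {t : ℝ} {w : ℂ}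
    (hw : 1 < ‖w‖) : C.map t (WholePlaneLoewner.BackwardFlow.invMap lam t w) = w := by
  rw [C.map_eq_loewnerMap hlam (C.invMap_notMem_hull hlam hw),
    WholePlaneLoewner.BackwardFlow.loewnerMap_invMap hlam t hw]

/-- `F_t({1 < |w|}) = ℂ ∖ K_t`. [folklore] -/
theorem image_invMap_eq_compl_hull (C : WholePlaneLoewnerChain lam) (hlam : Continuous lam) (t : ℝ) :
    WholePlaneLoewner.BackwardFlow.invMap lam t '' exteriorDisc = (C.hull t)ᶜ := by
  rw [C.hull_eq_loewnerHull hlam, WholePlaneLoewner.BackwardFlow.compl_loewnerHull]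
  rfl

/-- Off the hull, the interior coordinate `1/g_t(z)` lies in the open unit disc. [folklore] -/
theorem norm_inv_map_lt_one (C : WholePlaneLoewnerChain lam) {t : ℝ} {z : ℂ} (hz : z ∉ C.hull t) :
    ‖(C.map t z)⁻¹‖ < 1 := by
  rw [norm_inv]
  exact inv_lt_one_of_one_lt₀ (C.one_lt_norm_map hz)

/-! ### The radial Markov property (Miller–Sheffield (2013), §2.1.3) -/

section Markov

variable (C : WholePlaneLoewnerChain lam)

/-- The whole-plane field of the driving angle `-lam` is the interior field `dfield lam` of
`WholePlaneLoewnerDefs` (driving point `e^{-i lam}`). [cite: Lawler2005, Remark 4.22] -/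
theorem _root_.Literature.Probability.RandomPlanarGeometry.WholePlaneLoewner.field_neg_eq_dfield
    (lam : ℝ → ℝ) (t : ℝ) (k : ℂ) :
    WholePlaneLoewner.field (fun s ↦ -lam s) t k = WholePlaneLoewner.dfield lam t k := by
  simp only [WholePlaneLoewner.field_apply, WholePlaneLoewner.dfield_apply,
    WholePlaneLoewner.drivingPt_apply, ofReal_neg, neg_mul]

/-- **The inverted Loewner trajectory solves the radial equation of the shifted driver**: for
`z ∉ K_{b+u}`, `u ≥ 0`, the interior coordinate `s ↦ 1/g_{b+s}(z)` has derivative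
`Disc.field (shiftDriver lam b) u (1/g_{b+u}(z))` at `s = u` (Miller–Sheffield (2013), §2.1.3:
"`1/g_s(K_t ∖ K_s)` … is a radial SLE_κ process in `𝔻`"; Lawler (2005), Remark 4.22).
[cite: MillerSheffield2013, §2.1.3] -/
theorem hasDerivAt_invCoord {b u : ℝ} {z : ℂ} (hz : z ∉ C.hull (b + u)) (hu : 0 ≤ u) :
    HasDerivAt (fun s : ℝ ↦ (C.map (b + s) z)⁻¹)
      (RadialLoewner.Disc.field (WholePlaneLoewner.shiftDriver lam b) u (C.map (b + u) z)⁻¹) u := by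
  have h := HasDerivAt.comp_const_add b u (C.hasDerivAt_inv_map hz)
  rwa [WholePlaneLoewner.field_neg_eq_dfield, WholePlaneLoewner.dfield_eq_disc_field b hu] at h

/-- **The radial solution through `1/g_b(z)`**: for `z ∉ K_{b+u}` the interior coordinate
`s ↦ 1/g_{b+s}(z)` is a solution of the radial Loewner equation in `𝔻` driven by the shifted
driver, started at `1/g_b(z)`, with lifetime `> u`. [cite: MillerSheffield2013, §2.1.3] -/
theorem exists_disc_isSolution (hlam : Continuous lam) {b : ℝ} {u : ℝ≥0} {z : ℂ}
    (hz : z ∉ C.hull (b + u)) :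
    ∃ T' : ℝ≥0, u < T' ∧ RadialLoewner.Disc.IsSolution (WholePlaneLoewner.shiftDriver lam b)
      (C.map b z)⁻¹ (fun s ↦ (C.map (b + s) z)⁻¹) T' := by
  obtain ⟨ε, hε, hfar⟩ := C.exists_forall_notMem_hull hlam hz
  set ε' : ℝ≥0 := ⟨ε, hε.le⟩ with hε'def
  have hcoe : (ε' : ℝ) = ε := rfl
  have hε' : (0 : ℝ≥0) < ε' := by rw [← NNReal.coe_pos, hcoe]; exact hε
  have hlt : ∀ s : ℝ, s ∈ RadialLoewner.Disc.timeDom ((u + ε' : ℝ≥0) : WithTop ℝ≥0) →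
      0 ≤ s ∧ s < u + ε := fun s hs ↦ by
    obtain ⟨hs0, hs'⟩ := Loewner.mem_timeDomain_coe_iff.1 hs
    rw [NNReal.coe_add, hcoe] at hs'
    exact ⟨hs0, hs'⟩
  refine ⟨u + ε', lt_add_of_pos_right u hε', by simp, fun s hs ↦ ?_, fun s hs hsT ↦ ?_⟩
  · obtain ⟨hs0, hs'⟩ := hlt s hs
    have hzs : z ∉ C.hull (b + s) := hfar (b + s) (by linarith)
    exact (C.hasDerivAt_invCoord hzs hs0).hasDerivWithinAt
  · obtain ⟨-, hs'⟩ := hlt s ⟨hs, hsT⟩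
    have hzs : z ∉ C.hull (b + s) := hfar (b + s) (by linarith)
    exact RadialLoewner.Disc.ne_drivingPt_of_norm_lt_one _ (C.norm_inv_map_lt_one hzs) s

/-- **The radial Markov property of the whole-plane Loewner chain — swallowing.** For `z ∉ K_b`
and `u ≥ 0`: `z ∉ K_{b+u}` iff the interior point `1/g_b(z)` is not yet swallowed at time `u` by the
radial Loewner chain in `𝔻` driven by the shifted driver `s ↦ -lam (b + s)`. (`⇒`: the inverted
trajectory is a radial solution alive beyond `u`; `⇐`: the maximal radial solution, inverted, is a
forward solution of the whole-plane equation outside the closed disc on `[b, b+u]`, which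
determines the chain, `notMem_hull_of_solution`.) Miller–Sheffield (2013), §2.1.3 ("the growth
process `1/g_s(K_t ∖ K_s)` for `t ≥ s` from `∂𝔻` to `0` is a radial … process in `𝔻`").
[cite: MillerSheffield2013, §2.1.3] -/
theorem notMem_hull_add_iff (hlam : Continuous lam) {b : ℝ} {z : ℂ} (hz : z ∉ C.hull b) (u : ℝ≥0) :
    z ∉ C.hull (b + u) ↔ (u : WithTop ℝ≥0) <
      RadialLoewner.Disc.swallowingTime (WholePlaneLoewner.shiftDriver lam b) (C.map b z)⁻¹ := by
  constructor
  · intro hzu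
    obtain ⟨T', hT', hsol⟩ := C.exists_disc_isSolution hlam hzu
    exact lt_of_lt_of_le (WithTop.coe_lt_coe.2 hT') hsol.le_swallowingTime
  · intro hu
    set U := WholePlaneLoewner.shiftDriver lam b with hUdef
    set w₀ := (C.map b z)⁻¹ with hw₀def
    have hU : Continuous U := WholePlaneLoewner.continuous_shiftDriver hlam b
    obtain ⟨G, hG⟩ := RadialLoewner.Disc.exists_isSolution_swallowingTime hU w₀
    have hw₀1 : ‖w₀‖ < 1 := C.norm_inv_map_lt_one hz
    have hw₀0 : w₀ ≠ 0 := inv_ne_zero (C.map_ne_zero hz)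
    have hdom : Icc (0 : ℝ) u ⊆ RadialLoewner.Disc.timeDom
        (RadialLoewner.Disc.swallowingTime U w₀) :=
      Loewner.Icc_subset_timeDomain (by simpa using hu)
    have hG1 : ∀ r ∈ Icc (0 : ℝ) u, ‖G r‖ < 1 := fun r hr ↦ hG.norm_lt_one hU hw₀1 hr.1 (hdom hr).2
    have hG0 : ∀ r ∈ Icc (0 : ℝ) u, G r ≠ 0 := fun r hr ↦ hG.ne_zero hU hw₀0 (hdom hr)
    -- the exterior candidate `v s = 1/G(s - b)` on `[b, b + u]`
    have key := C.notMem_hull_of_solution hlam (b := b) (T := b + u) (by simp) hz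
      (u := fun s ↦ (G (s - b))⁻¹) (by simp [hG.apply_zero, hw₀def]) ?_ ?_ ?_
    · exact key.1
    · have hc : ContinuousOn G (Icc 0 u) := hG.continuousOn.mono hdom
      refine ContinuousOn.inv₀ (hc.comp (continuousOn_id.sub continuousOn_const) ?_) ?_
      · intro s hs; exact ⟨by linarith [hs.1], by linarith [hs.2]⟩
      · intro s hs; exact hG0 _ ⟨by linarith [hs.1], by linarith [hs.2]⟩
    · intro s hs
      have hr : s - b ∈ Ioc (0 : ℝ) u := ⟨by linarith [hs.1], by linarith [hs.2]⟩
      have hr' : s - b ∈ Icc (0 : ℝ) u := ⟨hr.1.le, hr.2⟩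
      have hGd : HasDerivWithinAt G (RadialLoewner.Disc.field U (s - b) (G (s - b))) (Iic (s - b))
          (s - b) :=
        RadialLoewner.Disc.hasDerivWithinAt_Iic_of_isIntegralCurveOn hdom hG.isIntegralCurveOn _ hr
      have h2 : HasDerivWithinAt (G ∘ fun x : ℝ ↦ x - b)
          ((1 : ℝ) • RadialLoewner.Disc.field U (s - b) (G (s - b))) (Iic s) s := by
        refine HasDerivWithinAt.scomp (g₁ := G) (h := fun x : ℝ ↦ x - b) (t' := Iic (s - b)) s ?_
          ((hasDerivWithinAt_id s (Iic s)).sub_const b) ?_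
        · exact hGd
        · intro r hr
          exact sub_le_sub_right (show r ≤ s from hr) b
      rw [one_smul] at h2
      have h2' : HasDerivWithinAt (fun y : ℝ ↦ G (y - b))
          (RadialLoewner.Disc.field U (s - b) (G (s - b))) (Iic s) s := h2
      have h3 := h2'.inv (hG0 _ hr')
      refine h3.congr_deriv ?_
      have hk0 : G (s - b) ≠ 0 := hG0 _ hr'
      have hξ : WholePlaneLoewner.drivingPt lam (b + (s - b)) - G (s - b) ≠ 0 :=
        sub_ne_zero.2 (WholePlaneLoewner.ne_drivingPt_of_norm_lt_one (hG1 _ hr') _).symm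
      rw [← WholePlaneLoewner.dfield_eq_disc_field b hr.1.le, WholePlaneLoewner.inv_field_eq _ hk0 hξ,
        add_sub_cancel]
    · intro s hs
      have hr : s - b ∈ Icc (0 : ℝ) u := ⟨by linarith [hs.1], by linarith [hs.2]⟩
      change 1 < ‖(G (s - b))⁻¹‖
      rw [norm_inv]
      exact (one_lt_inv₀ (norm_pos_iff.2 (hG0 _ hr))).2 (hG1 _ hr)

/-- **The radial Markov property — hulls**: for `z ∉ K_b`, `z ∈ K_{b+u}` iff `1/g_b(z)` lies in
the radial hull at time `u` of the shifted driver. [cite: MillerSheffield2013, §2.1.3] -/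
theorem mem_hull_add_iff (hlam : Continuous lam) {b : ℝ} {z : ℂ} (hz : z ∉ C.hull b) (u : ℝ≥0) :
    z ∈ C.hull (b + u) ↔
      (C.map b z)⁻¹ ∈ RadialLoewner.Disc.hull (WholePlaneLoewner.shiftDriver lam b) u := by
  have h := C.notMem_hull_add_iff hlam hz u
  simp only [RadialLoewner.Disc.hull, mem_setOf_eq, mem_ball_zero_iff, C.norm_inv_map_lt_one hz,
    true_and]
  rw [← not_lt, ← h, not_not]

/-- **The radial Markov property — maps**: while `z ∉ K_{b+u}`,
`g_{b+u}(z) = 1 / k_u(1/g_b(z))` with `k_u` the radial Loewner map in `𝔻` of the shifted driver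
(`RadialLoewner.Disc.map`). Miller–Sheffield (2013), §2.1.3 (`1/g_s(K_t ∖ K_s)`).
[cite: MillerSheffield2013, §2.1.3] -/
theorem map_add_eq (hlam : Continuous lam) {b : ℝ} {u : ℝ≥0} {z : ℂ} (hzu : z ∉ C.hull (b + u)) :
    C.map (b + u) z =
      (RadialLoewner.Disc.map (WholePlaneLoewner.shiftDriver lam b) u (C.map b z)⁻¹)⁻¹ := by
  obtain ⟨T', hT', hsol⟩ := C.exists_disc_isSolution hlam hzu
  rw [RadialLoewner.Disc.map_eq_of_isSolution (WholePlaneLoewner.continuous_shiftDriver hlam b) hsol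
    (WithTop.coe_lt_coe.2 hT'), inv_inv]

/-- **The Loewner domain after time `b` in interior coordinates**: `ℂ ∖ K_{b+u}` consists of the
points `z ∉ K_b` whose interior coordinate `1/g_b(z)` lies in the radial Loewner domain at time
`u` of the shifted driver. [cite: MillerSheffield2013, §2.1.3] -/
theorem compl_hull_add_eq (hlam : Continuous lam) (b : ℝ) (u : ℝ≥0) :
    (C.hull (b + u))ᶜ = {z | z ∉ C.hull b ∧
      (C.map b z)⁻¹ ∈ RadialLoewner.Disc.domain (WholePlaneLoewner.shiftDriver lam b) u} := by
  ext z
  constructor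
  · intro hzu
    have hz : z ∉ C.hull b := fun h ↦ hzu (C.hull_mono (by simp) h)
    exact ⟨hz, (RadialLoewner.Disc.mem_domain_iff _ _ _).2
      ⟨mem_ball_zero_iff.2 (C.norm_inv_map_lt_one hz), (C.notMem_hull_add_iff hlam hz u).1 hzu⟩⟩
  · rintro ⟨hz, hw⟩
    exact (C.notMem_hull_add_iff hlam hz u).2 ((RadialLoewner.Disc.mem_domain_iff _ _ _).1 hw).2

/-- Every point of the punctured unit disc is the interior coordinate `1/g_b(z)` of a unique
point `z = F_b(1/w) ∉ K_b`. [folklore] -/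
theorem exists_invCoord_eq (hlam : Continuous lam) {b : ℝ} {w : ℂ} (hw0 : w ≠ 0) (hw1 : ‖w‖ < 1) :
    WholePlaneLoewner.BackwardFlow.invMap lam b w⁻¹ ∉ C.hull b ∧
      (C.map b (WholePlaneLoewner.BackwardFlow.invMap lam b w⁻¹))⁻¹ = w := by
  have hwinv : 1 < ‖w⁻¹‖ := by
    rw [norm_inv]; exact (one_lt_inv₀ (norm_pos_iff.2 hw0)).2 hw1
  exact ⟨C.invMap_notMem_hull hlam hwinv, by rw [C.map_invMap hlam hwinv, inv_inv]⟩

/-- **`1/g_b` carries `ℂ ∖ K_{b+u}` onto the radial domain minus the origin.**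
[cite: MillerSheffield2013, §2.1.3] -/
theorem image_invCoord_compl_hull (hlam : Continuous lam) (b : ℝ) (u : ℝ≥0) :
    (fun z ↦ (C.map b z)⁻¹) '' (C.hull (b + u))ᶜ =
      RadialLoewner.Disc.domain (WholePlaneLoewner.shiftDriver lam b) u \ {0} := by
  ext w
  rw [C.compl_hull_add_eq hlam]
  constructor
  · rintro ⟨z, ⟨hz, hzw⟩, rfl⟩
    exact ⟨hzw, inv_ne_zero (C.map_ne_zero hz)⟩
  · rintro ⟨hw, hw0⟩
    have hw1 : ‖w‖ < 1 := mem_ball_zero_iff.1 (RadialLoewner.Disc.domain_subset _ _ hw)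
    obtain ⟨hz, hzw⟩ := C.exists_invCoord_eq hlam (b := b) hw0 hw1
    exact ⟨_, ⟨hz, by rwa [hzw]⟩, hzw⟩

/-- **`1/g_b` carries `K_{b+u} ∖ K_b` onto the radial hull at time `u`** (Miller–Sheffield
(2013), §2.1.3: "the growth process `1/g_s(K_t ∖ K_s)` for `t ≥ s`"). [cite: MillerSheffield2013, §2.1.3] -/
theorem image_invCoord_diff_hull (hlam : Continuous lam) (b : ℝ) (u : ℝ≥0) :
    (fun z ↦ (C.map b z)⁻¹) '' (C.hull (b + u) \ C.hull b) =
      RadialLoewner.Disc.hull (WholePlaneLoewner.shiftDriver lam b) u := by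
  ext w
  constructor
  · rintro ⟨z, ⟨hzu, hz⟩, rfl⟩
    exact (C.mem_hull_add_iff hlam hz u).1 hzu
  · intro hw
    have hw1 : ‖w‖ < 1 := mem_ball_zero_iff.1 (RadialLoewner.Disc.hull_subset _ _ hw)
    have hw0 : w ≠ 0 := by
      rintro rfl
      exact (RadialLoewner.Disc.zero_mem_domain (WholePlaneLoewner.shiftDriver lam b) u).2 hw
    obtain ⟨hz, hzw⟩ := C.exists_invCoord_eq hlam (b := b) hw0 hw1
    exact ⟨_, ⟨(C.mem_hull_add_iff hlam hz u).2 (by rwa [hzw]), hz⟩, hzw⟩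

end Markov

end WholePlaneLoewnerChain

end Literature.Probability.RandomPlanarGeometry
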